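import Mathlib
import HarnessLib
import Summits.AtomisticToContinuum.Crystallization.Theorems.PricedLinkCensusSoftFourRingsCapTypePartners
import Summits.AtomisticToContinuum.Crystallization.Theorems.PricedLinkCensusSoftFourRingsWings

/-!
# Soft four-rings, endgame: wings and closed vertex sets

Support file for `SoftFourRings` (route `PricedLinkCensus`, sub-problem `Crystallization`),
endgame steps (E2)–(E3) of the evidence file (§12.8), point-level form.

* `wing_cell` — for type-A data `(a, b, c, d)` at `v` and type-A data `(a₃, b₃, c₃, v)` at the
  `γ`-partner `d`, a point `x ∉ N[v]` bonded to `d` through a facet that is not a bond triangle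
  is a wing `a₃` or `c₃` of the `α`-bond `{d, b₃}` (else that hull edge would lie in three facets);
* `five_le_card_sdiff_of_closed` — a bond-closed proper subset of `X` misses at least five
  points (a point outside it has its four bonds outside it).

**`Cap` variant** (seat c3 of stmt-AtomisticToContinuum-14234): identical to `PricedLinkCensusSoftFourRingsWings`, except that the
global Tammes-13 hypothesis `(hT : musinTarasov2012_tammes_thirteen)` is replaced by the LOCAL covering
property of the twelve directions, `hT : ∀ p, ‖p‖ = 1 → ∃ x ∈ X, dist p x < 0.957` (no empty cap of
angular radius `57.18°`), which is all the two roots (`FacetCap`, `Interior`) ever used; the hT-free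
lemmas are not repeated (the original file is imported for them).
-/

namespace Summit.AtomisticToContinuum.Crystallization.Theorems.Cap

open Real RealInnerProductSpace Literature.Geometry.DiscreteGeometry

section Setting

open scoped Classical in
/-- **A cell neighbour of the `γ`-partner is a wing of its `α`-bond.** -/
theorem wing_cell
    {X : Finset (EuclideanSpace ℝ (Fin 3))}
    {B : Finset (Finset (EuclideanSpace ℝ (Fin 3)))}
    (hT : ∀ p : EuclideanSpace ℝ (Fin 3), ‖p‖ = 1 → ∃ x ∈ X, dist p x < 0.957)
    (hX1 : ∀ y ∈ X, ‖y‖ = 1)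
    (hcard : X.card = 12)
    (hsepX : ∀ u ∈ X, ∀ u' ∈ X, u ≠ u' → ⟪u, u'⟫ ≤ 1 - 1 / (2 * (101 / 100 : ℝ) ^ 2))
    (hB : ∀ T ∈ B, ∃ u ∈ X, ∃ u' ∈ X, u ≠ u' ∧ 1 - (101 / 100 : ℝ) ^ 2 / 2 ≤ ⟪u, u'⟫ ∧ T = {u, u'})
    (hBcard : B.card = 24) {v d a₃ b₃ c₃ x : EuclideanSpace ℝ (Fin 3)}
    (hN₃ : ∀ y, ({d, y} : Finset (EuclideanSpace ℝ (Fin 3))) ∈ B ↔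
      (y = a₃ ∨ y = b₃ ∨ y = c₃ ∨ y = v))
    (hd₃ : a₃ ≠ b₃ ∧ a₃ ≠ c₃ ∧ a₃ ≠ v ∧ b₃ ≠ c₃ ∧ b₃ ≠ v ∧ c₃ ≠ v)
    (hab₃ : ({a₃, b₃} : Finset (EuclideanSpace ℝ (Fin 3))) ∈ B)
    (hbc₃ : ({b₃, c₃} : Finset (EuclideanSpace ℝ (Fin 3))) ∈ B)
    (hxv : x ≠ v) (hxd : ({x, d} : Finset (EuclideanSpace ℝ (Fin 3))) ∈ B)
    (hf : ∃ c₀ ∈ facetNormals X, x ∈ tightSet X c₀ ∧ d ∈ tightSet X c₀ ∧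
      ¬ ((tightSet X c₀).card = 3 ∧ ((edgesOfFacet X c₀).filter (fun T => T ∉ B)).card = 0)) :
    x = a₃ ∨ x = c₃ := by
  obtain ⟨h0, hBH, -⟩ := hull_counts_of_twelve hT hX1 hcard hsepX hB hBcard
  have hdx : ({d, x} : Finset (EuclideanSpace ℝ (Fin 3))) ∈ B := by
    rw [Finset.pair_comm]; exact hxd
  rcases (hN₃ x).1 hdx with h | h | h | h
  · exact Or.inl h
  · -- `x = b₃`: the `α`-bond `{d, b₃}` would lie in three facets
    exfalso
    subst h
    obtain ⟨c₀, hc₀F, hxc₀, hdc₀, hnot⟩ := hf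
    have hda : ({d, a₃} : Finset (EuclideanSpace ℝ (Fin 3))) ∈ B := (hN₃ a₃).2 (Or.inl rfl)
    have hdc : ({d, c₃} : Finset (EuclideanSpace ℝ (Fin 3))) ∈ B :=
      (hN₃ c₃).2 (Or.inr (Or.inr (Or.inl rfl)))
    have hdv : d ≠ x := ne_of_mem_bonds hB hdx
    have hda' : d ≠ a₃ := ne_of_mem_bonds hB hda
    have hdc' : d ≠ c₃ := ne_of_mem_bonds hB hdc
    -- the two bond triangles through `{d, x}`
    obtain ⟨c₁, hc₁F, hc₁T, hc₁nb⟩ := bt_facet_of_bonds hX1 hsepX hB hda hab₃ hdx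
    obtain ⟨c₂, hc₂F, hc₂T, hc₂nb⟩ := bt_facet_of_bonds hX1 hsepX hB hdx hbc₃ hdc
    have hc₁3 : (tightSet X c₁).card = 3 := by
      rw [hc₁T, Finset.card_insert_of_notMem, Finset.card_pair hd₃.1]
      simp only [Finset.mem_insert, Finset.mem_singleton, not_or]
      exact ⟨hda', hdv⟩
    have hc₂3 : (tightSet X c₂).card = 3 := by
      rw [hc₂T, Finset.card_insert_of_notMem, Finset.card_pair hd₃.2.2.2.1]
      simp only [Finset.mem_insert, Finset.mem_singleton, not_or]
      exact ⟨hdv, hdc'⟩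
    have h01 : c₀ ≠ c₁ := fun h => hnot ⟨h ▸ hc₁3, h ▸ hc₁nb⟩
    have h02 : c₀ ≠ c₂ := fun h => hnot ⟨h ▸ hc₂3, h ▸ hc₂nb⟩
    have h12 : c₁ ≠ c₂ := by
      intro h
      have : a₃ ∈ tightSet X c₂ := by rw [← h, hc₁T]; simp
      rw [hc₂T] at this
      simp only [Finset.mem_insert, Finset.mem_singleton] at this
      rcases this with h' | h' | h'
      · exact hda' h'.symm
      · exact hd₃.1 h'
      · exact hd₃.2.1 h'
    have hsub : ∀ c', d ∈ tightSet X c' → x ∈ tightSet X c' →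
        ({d, x} : Finset (EuclideanSpace ℝ (Fin 3))) ⊆ tightSet X c' := by
      intro c' h1 h2 y hy
      rw [Finset.mem_insert, Finset.mem_singleton] at hy
      rcases hy with rfl | rfl <;> assumption
    refine false_of_three_facetsOfEdge hX1 h0 (hBH hdx) hc₀F hc₁F hc₂F (hsub c₀ hdc₀ hxc₀)
      (hsub c₁ (by rw [hc₁T]; simp) (by rw [hc₁T]; simp))
      (hsub c₂ (by rw [hc₂T]; simp) (by rw [hc₂T]; simp)) h01 h02 h12
  · exact Or.inr h
  · exact absurd h hxv

end Setting

end Summit.AtomisticToContinuum.Crystallization.Theorems.Cap
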